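import Literature.MathematicalPhysics.QuantumFieldTheory.Balaban1983to89.Node00.MultiScaleFibreChartMultiplier
import Literature.MathematicalPhysics.QuantumFieldTheory.Balaban1983to89.Node00.MultiScaleFibreChartLagrangeB

/-!
# NODE 00 — THE CURVATURE BOUND, THE DATUM DICTIONARY AND THE MULTIPLIER LETTER (μ) AT THE **BOND-DATUM** CHART `msChartB` — the print-datum ([Balaban1984PropagatorsII] (2.3)) edition of
# `Node00/MultiScaleFibreChartMultiplier` §3–§4 (its §1–§2 norm∕bilinear algebra is datum-free and REUSED), keyed on the lane's `Node00/MultiScaleFibreChartB ∕ …LagrangeB`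

statement-level skeleton of published theorems with citation tags; proofs where landed; nothing here is a claim about
the Yang–Mills mass gap

Cell `pub-ymgap` (HUMAN RULINGS D-0062 ∕ D-0149), lane `pub-ymgap-dag-n12-c` g35 (R134 seat (a), N12 = [B15], s1, lane owner); `--kind proof --supports` K1⁹ `stmt-QuantumFields-27364`;
count-neutral.  THEOREMS ONLY (0 `def`, 0 `instance`, 0 `sorry`).  (E1) variant (iii-b), class (γ) of the lane's census-by-declaration (bus [DAGN12C-G35], 2026-08-30): the parent's
`msChart_eq_msChart_avgFamily_of_agreeOn` (the dictionary between the lane's datum and dag-n10-w1's self-datum) is used by N12's junction of record v14ᴸ; the curvature bound and the (μ) letter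
travel with it.  GENERATOR twin (HOME `lean/g35/gen/gen_MultB.py`, substitutions asserted); the parent's `…_Bj_…` specialisation becomes the generic-𝔅 `…_of_isMinimizerB_regMSCoPOfRecord` with `h𝔅`
displayed (`lamBondsSeq_of_gt` ∕ `Bj_of_gt` at the two families).

HONESTY GUARD (director-ym №338 (5)).  PURELY ADDITIVE: the parent stays landed and true on its own text; nothing in it is edited; no displayed premise of any consumer is deleted or weakened.
LOCATED (inherited from the parent): the curvature constant `M₂` is per torus (finite-dimensionality), NOT print's volume-uniform `O(1)`.  Nothing of [15] asserted; K0⁷ ∕ K1⁹ NOT closed; N07 ∕ N12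
NOT discharged; one finite 𝕋⁴ programme at fixed ε — NOT continuum ∕ ℝ⁴ ∕ OS ∕ mass gap ∕ Clay.

WHAT IS HERE.  §3 ★ `exists_chartCurvatureB_sq_bound` · `exists_chartCurvatureB_sq_bound_seminorm`; §3½ `msChartB_congr_of_agreeOnB` · ★ `msChartB_eq_msChartB_avgFamily_of_agreeOnB`; §4 ★★★
`exists_lam_mu_msChartB_of_rightInverse_fun` · ★★ `exists_lam_mu_msChartB_of_isMinimizerB_regMSCoPOfRecord`.

References: [Balaban1989LargeFieldII] (1.12) p.359, p.357; [15] = [Balaban1985Variational] Sect. C (44)–(48) p.285, (81)–(83) p.290, (170)–(171) p.305, p.299–300; [Balaban1985Averaging] (17)–(19)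
p.21; [III] = [Balaban1988Convergent] (2.10)–(2.13) pp.256–257; [II] = [Balaban1984PropagatorsII] (2.3) p.224.
-/

noncomputable section

namespace Literature.MathematicalPhysics.QuantumFieldTheory.Balaban1983to89.Node00
open Filter Topology
open T4Continuum (T4Family)
open B15DeterminingSets B15DeterminingSetsB
open T4AdjointCovarianceUnitary (lieSU)
open B14.Eq213DetSet (Bj Bj_of_gt)
open scoped Matrix.Norms.L2Operator BigOperators

section Curvature

variable {F : T4Family} {N : ℕ} [NeZero N]
variable {K k : ℕ} {𝔅 : BDetSet (F.P K)} {W : MSField (F.P K) (SU N)} {U : GaugeField (F.P K) 0 (SU N)}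

/-- ★ **THE CURVATURE OF THE CHART OF RECORD IS BOUNDED (PER TORUS)**: `∃ M₂ ≥ 0, ∀ w, ‖D²Ψ(0)(w,w)‖ ≤ M₂·‖w‖²` for `Ψ := msChartB F N K k 𝐁 W U₀` — the bilinear bound of §2 at
`D²Ψ(0) := fderiv ℝ (fderiv ℝ Ψ) 0` (the `Ψ₂` of `hasFDerivAt_fderiv_msChartB`).  LOCATED: `M₂` depends on the torus (finite-dimensionality), NOT print's volume-uniform `O(1)`.
[cite: Balaban1985Variational, Sect. C (44)–(48) p.285, (81)–(83) p.290; Balaban1989LargeFieldII, (1.12) p.359] -/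
theorem exists_chartCurvatureB_sq_bound :
    ∃ M₂ : ℝ, 0 ≤ M₂ ∧ ∀ w : PBond (F.P K) 0 → lieSU (Fin N),
      ‖fderiv ℝ (fderiv ℝ (msChartB F N K k 𝔅 W U)) 0 w w‖ ≤ M₂ * ‖w‖ ^ 2 :=
  exists_sq_bound_of_bilinear (fderiv ℝ (fderiv ℝ (msChartB F N K k 𝔅 W U)) 0)

/-- The same against the junction's seminorm: `‖D²Ψ(0)(w,w)‖ ≤ N·M₂·p(w)²` when `Σ_b ‖↑w_b‖²_op ≤ p(w)²`. [cite: Balaban1989LargeFieldII, (1.12) p.359; Balaban1985Averaging, (17)–(19) p.21] -/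
theorem exists_chartCurvatureB_sq_bound_seminorm (p : Seminorm ℝ (PBond (F.P K) 0 → lieSU (Fin N)))
    (hp : ∀ Y : PBond (F.P K) 0 → lieSU (Fin N), ∑ b, ‖(Y b : Matrix (Fin N) (Fin N) ℂ)‖ ^ 2 ≤ p Y ^ 2) :
    ∃ M₂ : ℝ, 0 ≤ M₂ ∧ ∀ w : PBond (F.P K) 0 → lieSU (Fin N),
      ‖fderiv ℝ (fderiv ℝ (msChartB F N K k 𝔅 W U)) 0 w w‖ ≤ N * M₂ * p w ^ 2 := by
  obtain ⟨M₂, hM₂, hB⟩ := exists_chartCurvatureB_sq_bound (F := F) (N := N) (K := K) (k := k) (𝔅 := 𝔅) (W := W) (U := U)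
  refine ⟨M₂, hM₂, fun w => (hB w).trans ?_⟩
  have hw := pi_norm_le_sqrt_card_mul_seminorm p hp w
  have hN : (0 : ℝ) ≤ N := Nat.cast_nonneg _
  have hsq : ‖w‖ ^ 2 ≤ N * p w ^ 2 := by
    have h0 : 0 ≤ ‖w‖ := norm_nonneg _
    calc ‖w‖ ^ 2 ≤ (Real.sqrt N * p w) ^ 2 := pow_le_pow_left₀ h0 hw 2
      _ = N * p w ^ 2 := by rw [mul_pow, Real.sq_sqrt hN]
  calc M₂ * ‖w‖ ^ 2 ≤ M₂ * (N * p w ^ 2) := mul_le_mul_of_nonneg_left hsq hM₂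
    _ = N * M₂ * p w ^ 2 := by ring

end Curvature

/-! ## §3½  The chart depends on the datum only through the constrained bonds -/

section Datum

variable {F : T4Family} {N : ℕ} [NeZero N]
variable {K k : ℕ} {𝔅 : BDetSet (F.P K)} {W W' : MSField (F.P K) (SU N)} {U : GaugeField (F.P K) 0 (SU N)}

/-- **THE CHART DEPENDS ON THE DATUM ONLY THROUGH THE CONSTRAINED BONDS**: data agreeing on `𝐁` give the SAME chart `msChartB … W U = msChartB … W′ U` (as functions) — the dictionary
between the lane owner's datum `M˙(Q_k^{s*}Ṽ)` (J-C) and dag-n10-w1's self-datum `M˙(U₀)` ((δ₂)∕`hsurj` modules D∕F∕G), which agree on `𝐁` by the fibre condition.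
[cite: Balaban1988Convergent, (2.10)–(2.12) p.256 (bookkeeping)] -/
theorem msChartB_congr_of_agreeOnB (h : ∀ j, ∀ c ∈ 𝔅 j, W j c = W' j c) :
    msChartB F N K k 𝔅 W U = msChartB F N K k 𝔅 W' U := by
  funext X i
  rw [msChartB_apply, msChartB_apply, relAvg, relAvg, h _ _ ((constrEnumB 𝔅 k).symm i).2.2]

/-- In particular, for `U₀` IN THE FIBRE of `W` the chart against `W` is the chart against `U₀`'s own averages `M˙(U₀)` (dag-n10-w1's form).
[cite: Balaban1988Convergent, (2.10)–(2.12) p.256 (bookkeeping)] -/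
theorem msChartB_eq_msChartB_avgFamily_of_agreeOnB (hU : AgreeOnB 𝔅 (avgFamily (avOfRecord F N K) U) W) :
    msChartB F N K k 𝔅 W U = msChartB F N K k 𝔅 (avgFamily (avOfRecord F N K) U) U :=
  msChartB_congr_of_agreeOnB fun j c hc => (hU j c hc).symm

end Datum

/-! ## §4  The multiplier letter (μ) assembled: `lam`, `hlam`, `hμ` from one call -/

section Multiplier

variable {F : T4Family} {N : ℕ} [NeZero N]
variable {K k : ℕ} {𝔅 : BDetSet (F.P K)} {W : MSField (F.P K) (SU N)} {U : GaugeField (F.P K) 0 (SU N)}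

/-- ★★★ **THE MULTIPLIER AND ITS LETTER (μ) AT THE CHART OF RECORD, FROM ONE CALL** (J-C's binders `lam`, `hlam`, and per-`X` `hμ` at `w := X_f′X`, with `Ψ₂ := D²Ψ(0)`): for `𝐁` with no member
above `k`, `U₀` in the fibre with guarded averages, the junction's seminorm `p` (`Σ_b‖↑Y_b‖²_op ≤ p(Y)²`), a right inverse `R` of `DΨ(0)` as a function with `p(Rv) ≤ ρ·‖v‖` (letters
(ρ♭)+(δ₂) combined; dag-n10-w1's function-currency right inverses), the CURRENT bound `|D(A∘expChart U₀)(0)x| ≤ j·p(x)` and curve-criticality of `U₀` on the fibre: there are `lam` and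
`μ ≥ 0` with `D(A∘expChart U₀)(0) = lam ∘ DΨ(0)` and `lam(D²Ψ(0)(w,w)) ≤ μ·p(w)²` for every `w` — `μ := j·ρ·N·M₂` with §3's per-torus curvature bound `M₂` (LOCATED: not print's uniform `O(1)`).
[cite: Balaban1989LargeFieldII, (1.12) p.359, p.357; Balaban1985Variational, (82)–(83) p.290, (170)–(171) p.305, Sect. C (44)–(48) p.285] -/
theorem exists_lam_mu_msChartB_of_rightInverse_fun (h𝔅 : ∀ j, k < j → 𝔅 j = ∅)
    (hU : AgreeOnB 𝔅 (avgFamily (avOfRecord F N K) U) W) (hsb : SmallBelow (avOfRecord F N K) k U)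
    (p : Seminorm ℝ (PBond (F.P K) 0 → lieSU (Fin N)))
    (hp : ∀ Y : PBond (F.P K) 0 → lieSU (Fin N), ∑ b, ‖(Y b : Matrix (Fin N) (Fin N) ℂ)‖ ^ 2 ≤ p Y ^ 2)
    {R : (Fin (constrCardB 𝔅 k) → lieSU (Fin N)) → PBond (F.P K) 0 → lieSU (Fin N)} (hR : ∀ v, fderiv ℝ (msChartB F N K k 𝔅 W U) 0 (R v) = v)
    {j ρ : ℝ} (hj0 : 0 ≤ j) (hρ0 : 0 ≤ ρ)
    (hj : ∀ x, |fderiv ℝ (fun Y : PBond (F.P K) 0 → lieSU (Fin N) => wilsonAction4 (expChart U Y)) 0 x| ≤ j * p x)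
    (hρ : ∀ v, p (R v) ≤ ρ * ‖v‖) (hcrit : IsCritOnFibreB F N K 𝔅 W U) :
    ∃ lam : (Fin (constrCardB 𝔅 k) → lieSU (Fin N)) →L[ℝ] ℝ, ∃ μ : ℝ, 0 ≤ μ ∧
      fderiv ℝ (fun Y : PBond (F.P K) 0 → lieSU (Fin N) => wilsonAction4 (expChart U Y)) 0 = lam.comp (fderiv ℝ (msChartB F N K k 𝔅 W U) 0) ∧
        ∀ w : PBond (F.P K) 0 → lieSU (Fin N), lam (fderiv ℝ (fderiv ℝ (msChartB F N K k 𝔅 W U)) 0 w w) ≤ μ * p w ^ 2 := by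
  obtain ⟨lam, hlam, hbd⟩ := exists_lam_msChartB_bound_of_rightInverse_fun h𝔅 hU hsb p (fun v => ‖v‖) hR hj0 hj hρ hcrit
  obtain ⟨M₂, hM₂, hcurv⟩ := exists_chartCurvatureB_sq_bound_seminorm (F := F) (N := N) (K := K) (k := k) (𝔅 := 𝔅) (W := W) (U := U) p hp
  refine ⟨lam, j * ρ * (N * M₂), by positivity, hlam, fun w => ?_⟩
  calc lam (fderiv ℝ (fderiv ℝ (msChartB F N K k 𝔅 W U)) 0 w w)
        ≤ |lam (fderiv ℝ (fderiv ℝ (msChartB F N K k 𝔅 W U)) 0 w w)| := le_abs_self _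
    _ ≤ j * ρ * ‖fderiv ℝ (fderiv ℝ (msChartB F N K k 𝔅 W U)) 0 w w‖ := hbd _
    _ ≤ j * ρ * (N * M₂ * p w ^ 2) := mul_le_mul_of_nonneg_left (hcurv w) (by positivity)
    _ = j * ρ * (N * M₂) * p w ^ 2 := by ring


/-- ★★ **THE SAME AT THE RE-KEYED N12 ENDPOINT's OBJECTS, generic bond datum** — class of record `regMSCoPOfRecord F N ν K k′ Ω`, a bond datum `𝔅` with no member above `k`, `U₀` a (2.12)
minimiser there: `hcrit` discharged by minimality (`isCritOnFibreB_of_isMinimizerB_regMSCoPOfRecord`), the fibre condition is part of `IsMinimizerB`; twin of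
`exists_lam_mu_msChart_Bj_of_isMinimizer_regMSCoPOfRecord` (whose `Bj_of_gt` becomes the displayed `h𝔅`; at print's datum `lamBondsSeq_of_gt`).
[cite: Balaban1989LargeFieldII, (1.12) p.359; Balaban1985Variational, (82)–(83) p.290, p.299–300; Balaban1988Convergent, (2.12)–(2.13) pp.256–257; Balaban1984PropagatorsII, (2.3) p.224] -/
theorem exists_lam_mu_msChartB_of_isMinimizerB_regMSCoPOfRecord (ν : Stage7Numerics) {k' : ℕ} (Ω : ℕ → Set (Site (F.P K) 0)) (h𝔅 : ∀ j, k < j → 𝔅 j = ∅)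
    {U₀ : GaugeField (F.P K) 0 (SU N)}
    (h : IsMinimizerB (avOfRecord F N K) (regMSCoPOfRecord F N ν K k' Ω) 𝔅 W U₀) (hsb : SmallBelow (avOfRecord F N K) k U₀)
    (p : Seminorm ℝ (PBond (F.P K) 0 → lieSU (Fin N)))
    (hp : ∀ Y : PBond (F.P K) 0 → lieSU (Fin N), ∑ b, ‖(Y b : Matrix (Fin N) (Fin N) ℂ)‖ ^ 2 ≤ p Y ^ 2)
    {R : (Fin (constrCardB 𝔅 k) → lieSU (Fin N)) → PBond (F.P K) 0 → lieSU (Fin N)}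
    (hR : ∀ v, fderiv ℝ (msChartB F N K k 𝔅 W U₀) 0 (R v) = v)
    {j ρ : ℝ} (hj0 : 0 ≤ j) (hρ0 : 0 ≤ ρ)
    (hj : ∀ x, |fderiv ℝ (fun Y : PBond (F.P K) 0 → lieSU (Fin N) => wilsonAction4 (expChart U₀ Y)) 0 x| ≤ j * p x)
    (hρ : ∀ v, p (R v) ≤ ρ * ‖v‖) :
    ∃ lam : (Fin (constrCardB 𝔅 k) → lieSU (Fin N)) →L[ℝ] ℝ, ∃ μ : ℝ, 0 ≤ μ ∧
      fderiv ℝ (fun Y : PBond (F.P K) 0 → lieSU (Fin N) => wilsonAction4 (expChart U₀ Y)) 0 = lam.comp (fderiv ℝ (msChartB F N K k 𝔅 W U₀) 0) ∧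
        ∀ w : PBond (F.P K) 0 → lieSU (Fin N), lam (fderiv ℝ (fderiv ℝ (msChartB F N K k 𝔅 W U₀)) 0 w w) ≤ μ * p w ^ 2 :=
  exists_lam_mu_msChartB_of_rightInverse_fun h𝔅 h.2.1 hsb p hp hR hj0 hρ0 hj hρ
    (isCritOnFibreB_of_isMinimizerB_regMSCoPOfRecord ν Ω h)

end Multiplier

end Literature.MathematicalPhysics.QuantumFieldTheory.Balaban1983to89.Node00

end
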